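import Summits.SmoothPoincare4.SmoothPoincare4.Theses.SullivanDual
import Literature.Geometry.Symplectic.TamingWitness
import Literature.Geometry.Kaehler.ManifoldFormsChart
import Literature.Geometry.Kaehler.ManifoldFormsFunSmulProofs
import Literature.Geometry.Kaehler.LocalForms
import Mathlib.Geometry.Manifold.BumpFunction

/-!
# Stub `stub_witnessClosed` of line `Sketch` (pencil-incompleteness) for crux `WitnessCharge`
(item stmt-SmoothPoincare4-7824; route `SullivanDual`, crux
`Summit.SmoothPoincare4.SmoothPoincare4.Theses.SullivanDual.WitnessCharge`; checked skeleton
`Cruxes/WitnessCharge/Lines/Sketch.lean`, STEP 0(c))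

**Taming witnesses without mass on the collar are closed.** Let `T` be a taming witness at
radius `ε` on `Σ ∖ p` (`Literature.Geometry.Symplectic.TamingWitness p ε J T`), with
`0 < ε < ε'` and the closed chart ball of radius `ε'` at `p` inside the chart target, and assume
the COLLAR PROPERTY (the conclusion of the neighbouring stub `stub_collar`, here a hypothesis):
for every radius `ε₂ ∈ (ε, ε')`, `T` kills every smooth `2`-form vanishing at all points outside
the punctured chart ball `B_{ε₂}`. Then `T (dη) = 0` for every smooth `1`-form `η`.

Proof. Pick `ε < r < ε₂ < ε'` and Mathlib's smooth bump `χ : SmoothBumpFunction (𝓡 4) p` with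
`rIn = ε`, `rOut = r` (its construction needs `closedBall (e p) r ⊆ e.target`, `e = extChartAt p`),
restricted to the open submanifold `Σ ∖ p` (`χ ∘ Subtype.val`, smooth by `contMDiff_subtype_val`).
Split `η = χ • η + (1 - χ) • η`; both pieces are smooth (`IsSmoothForm.fun_smul'`), so
`dη = d(χη) + d((1-χ)η)` (`mextDeriv_add`).
* `d(χη)` vanishes at every `x ∉ B_{ε₂}`: such an `x` is not in `tsupport χ ⊆ e.symm '' closedBall
  (e p) r` (`r < ε₂`), so `χη ≡ 0` near `x` and `d` is local
  (`mextDeriv_apply_eq_zero_of_eventuallyEq_zero`, `LocalForms.lean`); the collar property at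
  radius `ε₂` gives `T (d(χη)) = 0`.
* `d((1-χ)η)` is smooth and closed (`d ∘ d = 0`, `mextDeriv_mextDeriv`) and vanishes at every
  `x ∈ B_ε` (there `χ ≡ 1` near `x`, `SmoothBumpFunction.eventuallyEq_one_of_dist_lt`), so (W2)
  (`TamingWitness.eq_zero_of_vanishes`) gives `T (d((1-χ)η)) = 0`.
Linearity of `T` concludes. Everything except the final specialisation is proved for an
arbitrary smooth Hausdorff `4`-manifold `M` (`witnessClosed_of_collar`).

References: D. Sullivan, *Cycles for the dynamical study of foliated manifolds and complex
manifolds*, Invent. Math. 36 (1976), Thm. I.7 [Sullivan1976]; F. W. Warner, GTM 94 (1983),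
2.20–2.23 [WarnerGTM94].
-/

noncomputable section

-- the registered namespace `Summit.SmoothPoincare4.SmoothPoincare4.…` repeats a component
set_option linter.dupNamespace false

open scoped Manifold ContDiff Topology
open Set Filter Literature.Geometry.Kaehler Literature.Geometry.Symplectic
  Literature.Topology.FourManifolds

namespace Summit.SmoothPoincare4.SmoothPoincare4.Theorems.WitnessCharge.PencilIncompleteness

/-! ### Functions times forms vanishing near a point -/

section Local

variable {E : Type*} [NormedAddCommGroup E] [NormedSpace ℝ E]
  {H : Type*} [TopologicalSpace H] {I : ModelWithCorners ℝ E H}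
  {M : Type*} [TopologicalSpace M] [ChartedSpace H M]
  {F : Type*} [NormedAddCommGroup F] [NormedSpace ℝ F] {k : ℕ}

/-- A function times a form vanishes near `x` if the function vanishes near `x` (so that its
exterior derivative vanishes at `x`, `mextDeriv_apply_eq_zero_of_eventuallyEq_zero` of
`Literature.Geometry.Kaehler.LocalForms`). [folklore] -/
theorem eventually_fun_smul_eq_zero {ρ : M → ℝ} (α : MForm I M F k) {x : M}
    (h : ∀ᶠ y in 𝓝 x, ρ y = 0) : ∀ᶠ y in 𝓝 x, (ρ • α) y = 0 := by
  filter_upwards [h] with y hy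
  rw [Pi.smul_apply', hy, zero_smul]

end Local

/-! ### Smooth bumps seen from an open submanifold -/

section Bump

variable {E : Type*} [NormedAddCommGroup E] [NormedSpace ℝ E] [FiniteDimensional ℝ E]
  {H : Type*} [TopologicalSpace H] {I : ModelWithCorners ℝ E H}
  {M : Type*} [TopologicalSpace M] [ChartedSpace H M] {c : M} (f : SmoothBumpFunction I c)

/-- A point which is NOT in the chart ball of some radius `r > f.rOut` (i.e. not both in the chart
source and with chart image within `r` of that of the centre) lies outside the topological
support of the bump `f` (which is contained in the image of the closed `rOut`-ball under the
inverse chart). [folklore] -/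
theorem notMem_tsupport_bump_of_not_mem_chartBall [T2Space M] {x : M} {r : ℝ} (hr : f.rOut < r)
    (hx : ¬ (x ∈ (chartAt H c).source ∧ extChartAt I c x ∈ Metric.ball (extChartAt I c c) r)) :
    x ∉ tsupport f := by
  intro hxt
  obtain ⟨y, ⟨hy₁, hy₂⟩, rfl⟩ := f.tsupport_subset_symm_image_closedBall hxt
  have hyt : y ∈ (extChartAt I c).target := f.closedBall_subset ⟨hy₁, hy₂⟩
  refine hx ⟨?_, ?_⟩
  · rw [← extChartAt_source I]
    exact (extChartAt I c).map_target hyt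
  · rw [(extChartAt I c).right_inv hyt]
    exact Metric.mem_ball.2 (lt_of_le_of_lt (Metric.mem_closedBall.1 hy₁) hr)

/-- Restricted to an open submanifold `U`, the bump vanishes near every point of `U` whose image
is outside its topological support. [folklore] -/
theorem eventually_bump_val_eq_zero {U : TopologicalSpace.Opens M} {x : U}
    (hx : x.1 ∉ tsupport f) : ∀ᶠ y in 𝓝 x, f y.1 = 0 := by
  have h : (f : M → ℝ) =ᶠ[𝓝 x.1] 0 := notMem_tsupport_iff_eventuallyEq.1 hx
  exact continuous_subtype_val.continuousAt.eventually h

/-- Restricted to an open submanifold `U`, the bump equals `1` near every point of `U` in the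
chart source whose chart image is within `rIn` of that of the centre. [folklore] -/
theorem eventually_bump_val_eq_one {U : TopologicalSpace.Opens M} {x : U}
    (hs : x.1 ∈ (chartAt H c).source)
    (hd : dist (extChartAt I c x.1) (extChartAt I c c) < f.rIn) : ∀ᶠ y in 𝓝 x, f y.1 = 1 := by
  have h : (f : M → ℝ) =ᶠ[𝓝 x.1] 1 := f.eventuallyEq_one_of_dist_lt hs hd
  exact continuous_subtype_val.continuousAt.eventually h

end Bump

/-! ### Witnesses without mass on the collar are closed -/

section Witness

variable {M : Type*} [TopologicalSpace M] [T2Space M] [ChartedSpace (EuclideanSpace ℝ (Fin 4)) M]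
  [IsManifold (𝓡 4) ∞ M]

/-- **A taming witness with no mass on the collar kills exact forms** (general smooth Hausdorff
`4`-manifold `M`, point `p`): if `0 < ε < ε'`, the closed chart `ε'`-ball at `p` lies in the chart
target, `T` is a taming witness at radius `ε` and, for every `ε₂ ∈ (ε, ε')`, `T` kills every
smooth `2`-form vanishing outside the punctured chart ball `B_{ε₂}`, then `T (dη) = 0` for every
smooth `1`-form `η` on `M ∖ p`. Proof: bump decomposition `dη = d(χη) + d((1-χ)η)` with a smooth
bump `χ` (`rIn = ε < rOut < ε₂`); the first piece vanishes off `B_{ε₂}` (collar hypothesis), the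
second is closed and vanishes on `B_ε` ((W2)). [cite: Sullivan1976, Thm. I.7] -/
theorem witnessClosed_of_collar (p : M)
    (J : ∀ x : punctured p, TangentSpace (𝓡 4) x →L[ℝ] TangentSpace (𝓡 4) x) {ε ε' : ℝ}
    (hε : 0 < ε) (hεε' : ε < ε')
    (hball : Metric.closedBall (extChartAt (𝓡 4) p p) ε' ⊆ (extChartAt (𝓡 4) p).target)
    {T : MForm (𝓡 4) (punctured p) ℝ 2 →ₗ[ℝ] ℝ} (hT : TamingWitness p ε J T)
    (hcollar : ∀ (ε₂ : ℝ), ε < ε₂ → ε₂ < ε' →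
      ∀ (α : MForm (𝓡 4) (punctured p) ℝ 2), IsSmoothForm α →
        (∀ x : punctured p, ¬ InPuncturedChartBall p ε₂ x → α x = 0) → T α = 0)
    {η : MForm (𝓡 4) (punctured p) ℝ 1} (hη : IsSmoothForm η) : T (mextDeriv η) = 0 := by
  -- radii `ε < r < ε₂ < ε'`
  obtain ⟨r, ε₂, hεr, hrε₂, hε₂ε'⟩ : ∃ r ε₂ : ℝ, ε < r ∧ r < ε₂ ∧ ε₂ < ε' :=
    ⟨ε + (ε' - ε) / 3, ε + 2 * ((ε' - ε) / 3), by linarith, by linarith, by linarith⟩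
  -- the bump at `p`, `= 1` on the closed chart `ε`-ball, supported in the closed chart `r`-ball
  let χ : SmoothBumpFunction (𝓡 4) p :=
    ⟨⟨ε, r, hε, hεr⟩, fun y hy =>
      hball (Metric.closedBall_subset_closedBall (by linarith) hy.1)⟩
  -- its restriction to the open submanifold `M ∖ p`, and the complementary cut-off
  let χ' : punctured p → ℝ := fun x => χ x.1
  let ψ : punctured p → ℝ := fun x => 1 - χ x.1
  have hχ' : ContMDiff (𝓡 4) 𝓘(ℝ) ∞ χ' := χ.contMDiff.comp contMDiff_subtype_val
  have hψ : ContMDiff (𝓡 4) 𝓘(ℝ) ∞ ψ := contMDiff_const.sub hχ'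
  have h₁ : IsSmoothForm (χ' • η) := IsSmoothForm.fun_smul' hχ' hη
  have h₂ : IsSmoothForm (ψ • η) := IsSmoothForm.fun_smul' hψ hη
  -- `η = χ η + (1 - χ) η`, hence `dη = d(χ η) + d((1 - χ) η)`
  have hsplit : η = χ' • η + ψ • η := by
    funext x
    simp only [Pi.add_apply, Pi.smul_apply', χ', ψ]
    rw [sub_smul, one_smul, add_sub_cancel]
  have hd : mextDeriv η = mextDeriv (χ' • η) + mextDeriv (ψ • η) := by
    have h := mextDeriv_add h₁ h₂
    rwa [← hsplit] at h
  -- (i) `d(χ η)` vanishes off `B_{ε₂}`: killed by the collar property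
  have hi : T (mextDeriv (χ' • η)) = 0 := by
    refine hcollar ε₂ (hεr.trans hrε₂) hε₂ε' _
      (isSmoothForm_mextDeriv (inChart_mextDeriv_holds _ _ _) h₁) fun x hx => ?_
    refine mextDeriv_apply_eq_zero_of_eventuallyEq_zero (eventually_fun_smul_eq_zero η ?_)
    exact eventually_bump_val_eq_zero χ
      (notMem_tsupport_bump_of_not_mem_chartBall χ (r := ε₂) hrε₂ hx)
  -- (ii) `d((1 - χ) η)` is smooth, closed and vanishes on `B_ε`: killed by (W2)
  have hii : T (mextDeriv (ψ • η)) = 0 := by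
    refine hT.eq_zero_of_vanishes (isSmoothForm_mextDeriv (inChart_mextDeriv_holds _ _ _) h₂)
      (mextDeriv_mextDeriv (inChart_mextDeriv_holds _ _ _) h₂) fun x hx => ?_
    refine mextDeriv_apply_eq_zero_of_eventuallyEq_zero (eventually_fun_smul_eq_zero η ?_)
    have h1 : ∀ᶠ y in 𝓝 x, χ y.1 = 1 :=
      eventually_bump_val_eq_one χ hx.1 (Metric.mem_ball.1 hx.2)
    filter_upwards [h1] with y hy
    simp only [ψ, hy, sub_self]
  rw [hd, map_add, hi, hii, add_zero]

end Witness

/-- STEP 0(c) — **WITNESSES ARE CLOSED**: if a witness at radius `ε` has no mass on the collar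
(the conclusion of `stub_collar`, taken as a hypothesis), then `T (dη) = 0` for every smooth
`1`-form `η` on `Σ ∖ p`. Proof sketch: with a smooth bump `χ = 1` on `B_{ε₁}`, `supp χ ⊆ B_{ε₂}`,
`ε < ε₁ < ε₂ < ε'` (Mathlib `SmoothBumpFunction` at `p`, restricted to `Σ∖p`),
`dη = d(χη) + d((1-χ)η)`; the first vanishes off `B_{ε₂}` (collar), the second is closed and
vanishes on `B_ε` ((W2)). Specialisation of `witnessClosed_of_collar` to the carrier of a
homotopy `4`-sphere. [folklore] -/
theorem stub_witnessClosed :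
    ∀ (S : HomotopySphere 4) (p : S.carrier)
      (J : ∀ x : punctured p, TangentSpace (𝓡 4) x →L[ℝ] TangentSpace (𝓡 4) x) (ε ε' : ℝ),
      0 < ε → ε < ε' →
      Metric.closedBall (extChartAt (𝓡 4) p p) ε' ⊆ (extChartAt (𝓡 4) p).target →
      ∀ (T : MForm (𝓡 4) (punctured p) ℝ 2 →ₗ[ℝ] ℝ), TamingWitness p ε J T →
      (∀ (ε₂ : ℝ), ε < ε₂ → ε₂ < ε' →
        ∀ (α : MForm (𝓡 4) (punctured p) ℝ 2), IsSmoothForm α →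
          (∀ x : punctured p, ¬ InPuncturedChartBall p ε₂ x → α x = 0) → T α = 0) →
      ∀ (η : MForm (𝓡 4) (punctured p) ℝ 1), IsSmoothForm η → T (mextDeriv η) = 0 := by
  intro S p J ε ε' hε hεε' hball T hT hcollar η hη
  exact witnessClosed_of_collar p J hε hεε' hball hT hcollar hη

end Summit.SmoothPoincare4.SmoothPoincare4.Theorems.WitnessCharge.PencilIncompleteness

end
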